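import Literature.NumberTheory.Automorphic.ArchimedeanCharacterTwist
import Literature.NumberTheory.Automorphic.AutomorphicFormsSpan
import Literature.NumberTheory.Automorphic.StableSubmoduleLattice
import HarnessLib

/-!
# The split component `A_G` acts on an irreducible automorphic representation of `GL_n(𝔸_K)` by a
# quasi-character `a ↦ a^μ`

Topic `NumberTheory/Automorphic`. Let `π = W / W'` be an automorphic representation of
`GL_n(𝔸_K)` in the sense of Borel–Jacquet (a datum of `(𝔤, K_∞) × GL_n(𝔸_K^∞)`-stable subspaces
of the space of automorphic forms, `AutomorphicRepData (AutomorphyDatum.gl n K hcpt)`) realised on a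
subspace, `W' = ⊥` (every cuspidal `π` is, `cuspidal_W'_eq_bot`). The split component
`A_G = ℝ_{>0}` of the centre (positive real scalars at the archimedean places, `posRealScalar`) is
the one-parameter subgroup `exp (t · 1)` of the central element `1 ∈ 𝔤 = 𝔤𝔩_n(K_∞)`, and we prove:

* `AutomorphicRepData.exists_lieDeriv_one_eq_smul` — **the central element `1 ∈ 𝔤` acts on `W` by
  a scalar `μ`**: `Z(𝔤)`-finiteness of a non-zero `φ₀ ∈ W` gives a finite-dimensional
  `Z(𝔤)`-stable space containing `φ₀` on which the (central) Lie derivative along `1` has an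
  eigenvector; its eigenspace in `W` is `(𝔤, K_∞) × GL_n(𝔸_K^∞)`-stable (the element is central in
  `𝔤`, in `GL_n(K_∞)` and commutes with `GL_n(𝔸_K^∞)`), hence all of `W` by irreducibility
  (Schur's lemma in the form available without admissibility).
* `AutomorphicRepData.exists_apply_posRealScalar_mul_eq_cpow` — **`A_G` acts by `a ↦ a^μ`**:
  `φ (a g) = a^μ φ (g)` for `φ ∈ W`, `a ∈ A_G` (integrate the ODE `d/dt φ(g e^{t}) = μ φ(g e^{t})`
  along `exp (t · 1) = e^t · 1`, `posRealScalar_eq_ofArch_expMem`).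

This is the input "`π` has a central character on `A_G`" of the normalisation `π ↦ π ⊗ |det|^{-μ/n[K:ℚ]}`
making a cuspidal representation trivial on `A_G` (Borel–Jacquet 1979, 5.7; Arthur–Clozel 1989,
Ch. 3, proof of Thm. 3.1, "We may assume `π, π'` unitary"). Everything is proved; no definitions.

## References

* A. Borel, H. Jacquet, *Automorphic forms and automorphic representations*, Proc. Sympos. Pure
  Math. 33 (1979), part 1, §4.6, 5.7 [BorelJacquetCorvallis1979].
* J. Arthur, L. Clozel, *Simple algebras, base change, and the advanced theory of the trace
  formula* (1989), Ch. 3, proof of Thm. 3.1 [ArthurClozelAMS120].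
-/

-- Mathlib idiom (Mathlib/Algebra/Lie/OfAssociative.lean); needed to mention Lie subalgebras of matrix algebras
attribute [local instance 100] LieRing.ofAssociativeRing

noncomputable section

open scoped MatrixGroups NNReal Classical
open NumberField NumberField.mixedEmbedding IsDedekindDomain NormedSpace

namespace Literature.NumberTheory.Automorphic

section General

variable {A : Type*} [NormedCommRing A] [NormedAlgebra ℝ A] [NormedAlgebra ℚ A] [CompleteSpace A]
  [StarRing A] {N : Type*} [Fintype N] [DecidableEq N] {H : RealMatrixGroup A N}
  {G : Type*} [Group G] (ι : H.carrier →* G)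

/-- **Central elements of `𝔤` give commuting Lie derivatives** on smooth functions:
if `⁅Z, Y⁆ = 0` then `Z (Y φ) = Y (Z φ)` (`lieDeriv_bracket`). [folklore] -/
theorem lieDeriv_comm_of_lie_eq_zero [FiniteDimensional ℝ A] {Z Y : H.lie} (h : ⁅Z, Y⁆ = 0)
    {φ : G → ℂ} (hφ : IsArchSmooth ι φ) :
    lieDeriv ι Z (lieDeriv ι Y φ) = lieDeriv ι Y (lieDeriv ι Z φ) := by
  have := lieDeriv_bracket ι Z Y hφ
  rw [h, lieDeriv_zero_left] at this
  exact (sub_eq_zero.1 this.symm)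

/-- **One-parameter subgroups act through `exp`** along an eigenfunction: if `φ` is smooth in the
archimedean variable and `Z φ = μ φ`, then `φ (g · ι(exp tZ)) = e^{μ t} φ (g)` (the ODE
`u' = μ u` for `u(t) = φ (g ι(exp tZ))`, `IsArchSmooth.hasDerivAt_flow`). [folklore] -/
theorem apply_mul_expMem_eq_exp_mul_of_lieDeriv_eq_smul {Z : H.lie} {μ : ℂ} {φ : G → ℂ}
    (hφ : IsArchSmooth ι φ) (hZ : lieDeriv ι Z φ = μ • φ) (g : G) (t : ℝ) :
    φ (g * ι (H.expMem (t • Z))) = Complex.exp (μ * t) * φ g := by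
  set u : ℝ → ℂ := fun s => φ (g * ι (H.expMem (s • Z))) with hu
  have hu' : ∀ s, HasDerivAt u (μ * u s) s := fun s => by
    have := hφ.hasDerivAt_flow ι Z g s
    rw [hZ] at this
    exact this
  -- `w(s) = e^{-μ s} u(s)` is constant
  set w : ℝ → ℂ := fun s => Complex.exp (-(μ * s)) * u s with hw
  have hw' : ∀ s, HasDerivAt w 0 s := by
    intro s
    have he : HasDerivAt (fun s : ℝ => Complex.exp (-(μ * s))) (Complex.exp (-(μ * s)) * (-μ)) s := by
      have h0 := ((hasDerivAt_id s).ofReal_comp).const_mul (-μ)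
      have hf : (fun y : ℝ => -μ * ((id y : ℝ) : ℂ)) = fun s : ℝ => -(μ * (s : ℂ)) := by
        funext y; rw [id, neg_mul]
      rw [hf] at h0
      have h1 : HasDerivAt (fun s : ℝ => -(μ * (s : ℂ))) (-μ) s :=
        h0.congr_deriv (by rw [Complex.ofReal_one, mul_one])
      exact h1.cexp
    refine (he.mul (hu' s)).congr_deriv ?_
    ring
  have hconst := is_const_of_deriv_eq_zero (fun s => (hw' s).differentiableAt) (fun s => (hw' s).deriv) t 0
  simp only [hw, hu, mul_zero, neg_zero, Complex.exp_zero, one_mul, zero_smul,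
    RealMatrixGroup.expMem_zero', map_one, mul_one, Complex.ofReal_zero] at hconst
  -- `e^{-μt} u(t) = φ g`
  have hexp : Complex.exp (μ * t) * Complex.exp (-(μ * t)) = 1 := by
    rw [← Complex.exp_add, add_neg_cancel, Complex.exp_zero]
  calc φ (g * ι (H.expMem (t • Z))) = Complex.exp (μ * t) * (Complex.exp (-(μ * t)) * u t) := by
        rw [← mul_assoc, hexp, one_mul]
    _ = Complex.exp (μ * t) * φ g := by rw [hconst]

end General

/-! ### The central element `1 ∈ 𝔤𝔩_n(K_∞)` and the split component `A_G` -/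

section GLn

variable {n : ℕ} {K : Type} [Field K] [NumberField K] {hcpt : isCompact_glFiniteIntegralLevel n K}

/-- The scalar `e^t ∈ A_G ⊂ GL_n(𝔸_K)` is `exp (t · 1)` for the central element `1 ∈ 𝔤𝔩_n(K_∞)`:
`posRealScalar (e^t) = ofArch (exp (t · 1))` (`exp (t · 1) = e^t · 1` in `M_n(K_∞)`,
`realToInfiniteAdele` is `algebraMap ℝ (mixedSpace K)` transported along `ringEquiv_mixedSpace`).
[folklore] -/
theorem posRealScalar_eq_ofArch_expMem (t : ℝ≥0ˣ) :
    posRealScalar n K t = (AutomorphyDatum.gl n K hcpt).ofArch ((AutomorphyDatum.gl n K hcpt).arch.expMem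
      ((Real.log ((t : ℝ≥0) : ℝ)) • (⟨1, trivial⟩ : (AutomorphyDatum.gl n K hcpt).arch.lie))) := by
  have ht : (0 : ℝ) < ((t : ℝ≥0) : ℝ) := NNReal.coe_pos.2 (pos_iff_ne_zero.2 t.ne_zero)
  -- the matrix `exp ((log t) · 1) = t · 1`
  have hexp : (((AutomorphyDatum.gl n K hcpt).arch.expMem ((Real.log ((t : ℝ≥0) : ℝ)) • (⟨1, trivial⟩ :
      (AutomorphyDatum.gl n K hcpt).arch.lie)) : GL (Fin n) (mixedSpace K)) : Matrix (Fin n) (Fin n) (mixedSpace K)) =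
      algebraMap ℝ (Matrix (Fin n) (Fin n) (mixedSpace K)) ((t : ℝ≥0) : ℝ) := by
    rw [RealMatrixGroup.coe_expMem, coe_expGL]
    change exp ((Real.log ((t : ℝ≥0) : ℝ)) • (1 : Matrix (Fin n) (Fin n) (mixedSpace K))) = _
    set_option backward.isDefEq.respectTransparency false in
    open scoped Matrix.Norms.Operator in
    rw [← Algebra.algebraMap_eq_smul_one, ← algebraMap_exp_comm, ← Real.exp_eq_exp_ℝ, Real.exp_log ht]
  refine Matrix.GeneralLinearGroup.ext fun i j => ?_
  rw [AutomorphyDatum.gl_ofArch_apply, GLn.coe_ofInfinite_apply, hexp, Matrix.algebraMap_matrix_apply]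
  rw [posRealScalar, MonoidHom.comp_apply]
  change Matrix.scalar (Fin n) ((posRealIdele K t : (AdeleRing (𝓞 K) K)ˣ) : AdeleRing (𝓞 K) K) i j = _
  rw [Matrix.scalar_apply, Matrix.diagonal_apply]
  by_cases hij : i = j
  · subst hij
    rw [if_pos rfl, if_pos rfl]
    refine Prod.ext ?_ ?_
    · rw [posRealIdele_fst]; rfl
    · rw [posRealIdele_snd]; exact (Matrix.one_apply_eq i).symm
  · rw [if_neg hij, if_neg hij, map_zero, Matrix.one_apply_ne hij]
    rfl

/-- The matrix `exp (t · 1) = e^t · 1` in `M_n(K_∞)`. [folklore] -/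
theorem coe_expMem_smul_one (t : ℝ) :
    ((((AutomorphyDatum.gl n K hcpt).arch.expMem (t • (⟨1, trivial⟩ : (AutomorphyDatum.gl n K hcpt).arch.lie)) :
      GL (Fin n) (mixedSpace K)) : Matrix (Fin n) (Fin n) (mixedSpace K))) =
      algebraMap ℝ (Matrix (Fin n) (Fin n) (mixedSpace K)) (Real.exp t) := by
  rw [RealMatrixGroup.coe_expMem, coe_expGL]
  change exp (t • (1 : Matrix (Fin n) (Fin n) (mixedSpace K))) = _
  set_option backward.isDefEq.respectTransparency false in
  open scoped Matrix.Norms.Operator in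
  rw [← Algebra.algebraMap_eq_smul_one, ← algebraMap_exp_comm, ← Real.exp_eq_exp_ℝ]

/-- `exp (t · 1)` is central in `GL_n(K_∞)`. [folklore] -/
theorem expMem_smul_one_mul_comm (t : ℝ) (g : GL (Fin n) (mixedSpace K)) :
    ((AutomorphyDatum.gl n K hcpt).arch.expMem (t • (⟨1, trivial⟩ : (AutomorphyDatum.gl n K hcpt).arch.lie)) :
        GL (Fin n) (mixedSpace K)) * g =
      g * ((AutomorphyDatum.gl n K hcpt).arch.expMem (t • (⟨1, trivial⟩ :
        (AutomorphyDatum.gl n K hcpt).arch.lie)) : GL (Fin n) (mixedSpace K)) := by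
  refine Units.ext ?_
  rw [Units.val_mul, Units.val_mul, coe_expMem_smul_one]
  exact Algebra.commutes _ _

/-- `1 ∈ 𝔤𝔩_n(K_∞)` is central in `𝔤`. [folklore] -/
theorem lie_one_eq_zero (Y : (AutomorphyDatum.gl n K hcpt).arch.lie) :
    ⁅(⟨1, trivial⟩ : (AutomorphyDatum.gl n K hcpt).arch.lie), Y⁆ = 0 := by
  apply Subtype.ext
  rw [LieSubalgebra.coe_bracket, ZeroMemClass.coe_zero, LieRing.of_associative_ring_bracket]
  change (1 : Matrix (Fin n) (Fin n) (mixedSpace K)) * Y - Y * 1 = 0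
  rw [one_mul, mul_one, sub_self]

end GLn

/-! ### Lie derivatives and translations; stable subspaces and the word action -/

section Stable

variable {K : Type} [Field K] [NumberField K]
  {A : Type*} [NormedCommRing A] [NormedAlgebra ℝ A] [NormedAlgebra ℚ A] [CompleteSpace A]
  [StarRing A] {N : Type*} [Fintype N] [DecidableEq N]
  {𝒢 : AdelicGroupData K} {𝒟 : AutomorphyDatum 𝒢 A N}

/-- **Right translation by an element commuting with `ι(exp tX)` commutes with the Lie derivative
along `X`**: `X (r(h) ψ) = r(h) (X ψ)`. [folklore] -/
theorem lieDeriv_rightTranslation_of_forall_commute (X : 𝒟.arch.lie) {h : 𝒢.Adelic}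
    (hh : ∀ t : ℝ, 𝒟.ofArch (𝒟.arch.expMem (t • X)) * h = h * 𝒟.ofArch (𝒟.arch.expMem (t • X)))
    (ψ : 𝒢.Adelic → ℂ) :
    lieDeriv 𝒟.ofArch X (rightTranslation 𝒢 h ψ) = rightTranslation 𝒢 h (lieDeriv 𝒟.ofArch X ψ) := by
  funext g
  rw [rightTranslation_apply, lieDeriv, lieDeriv]
  congr 1
  funext t
  rw [rightTranslation_apply, mul_assoc, hh t, ← mul_assoc]

/-- The word action preserves stable subspaces (`p φ` is a linear combination of iterated Lie
derivatives of `φ`). [folklore] -/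
theorem IsStableSubmodule.applyFree_mem {W : Submodule ℂ (𝒢.Adelic → ℂ)} (hW : IsStableSubmodule 𝒟 W)
    (p : FreeAlgebra ℝ 𝒟.arch.lie) {φ : 𝒢.Adelic → ℂ} (hφ : φ ∈ W) :
    applyFree 𝒟.ofArch p φ ∈ W := by
  unfold applyFree
  rw [Finsupp.sum]
  exact Submodule.sum_mem _ fun w _ => Submodule.smul_mem _ _ (hW.iterLieDeriv_mem _ hφ)

end Stable

/-! ### The central element acts by a scalar; `A_G` acts by `a ↦ a^μ` -/

section Center

variable {n : ℕ} {K : Type} [Field K] [NumberField K] {hcpt : isCompact_glFiniteIntegralLevel n K}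

/-- **The central element `1 ∈ 𝔤𝔩_n(K_∞)` acts by a scalar on an irreducible automorphic
representation realised on a subspace** (`W' = ⊥`). For a non-zero `φ₀ ∈ W`, the `Z(𝔤)`-orbit span
`V` of `φ₀` is finite-dimensional (`Z(𝔤)`-finiteness), contained in `W`, and stable under the Lie
derivative `T` along `1` (`1 (z φ₀) = (ι 1 · z) φ₀` with `ι 1 · z` central); an eigenvector of `T|_V`
spans with its eigenvalue `μ` the eigenspace `E = {ψ ∈ W | 1 ψ = μ ψ}`, which is
`(𝔤, K_∞) × GL_n(𝔸_K^∞)`-stable (`1` is central in `𝔤`; `exp (t · 1)` is central in `GL_n(K_∞)` and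
commutes with `GL_n(𝔸_K^∞)`), non-zero and hence all of `W` by irreducibility. This is the form of
Schur's lemma for the split centre that needs no admissibility. Borel–Jacquet 1979, 4.6 and 5.7. [cite: BorelJacquetCorvallis1979, 5.7] -/
theorem AutomorphicRepData.exists_lieDeriv_one_eq_smul
    (π : AutomorphicRepData (AutomorphyDatum.gl n K hcpt)) (hW' : π.W' = ⊥) :
    ∃ μ : ℂ, ∀ φ ∈ π.W,
      lieDeriv (AutomorphyDatum.gl n K hcpt).ofArch (⟨1, trivial⟩ : (AutomorphyDatum.gl n K hcpt).arch.lie) φ =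
        μ • φ := by
  set H₀ : (AutomorphyDatum.gl n K hcpt).arch.lie := ⟨1, trivial⟩ with hH₀
  have hcent : ∀ Y : (AutomorphyDatum.gl n K hcpt).arch.lie, ⁅H₀, Y⁆ = 0 := lie_one_eq_zero
  have hsmooth : ∀ φ ∈ π.W, IsArchSmooth (AutomorphyDatum.gl n K hcpt).ofArch φ :=
    fun φ h => π.stable.isArchSmooth h
  -- a non-zero element and its `Z(𝔤)`-orbit span
  obtain ⟨φ₀, hφ₀W, hφ₀W'⟩ := SetLike.exists_of_lt π.lt
  have hφ₀0 : φ₀ ≠ 0 := fun h => hφ₀W' (h ▸ Submodule.zero_mem _)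
  set V := zOrbitSpan (AutomorphyDatum.gl n K hcpt).ofArch φ₀ with hV
  have hφ₀form : IsAutomorphicForm (AutomorphyDatum.gl n K hcpt) φ₀ :=
    isAutomorphicForm_of_mem_automorphicForms_gl (π.stable.le_automorphicForms hφ₀W)
  haveI : FiniteDimensional ℂ V := hφ₀form.zFinite
  have hVW : V ≤ π.W := Submodule.span_le.2 (by
    rintro _ ⟨p, -, rfl⟩
    exact π.stable.applyFree_mem p hφ₀W)
  have hVsmooth : ∀ ψ ∈ V, IsArchSmooth (AutomorphyDatum.gl n K hcpt).ofArch ψ :=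
    fun ψ h => hsmooth ψ (hVW h)
  have hTV : ∀ ψ ∈ V, lieDeriv (AutomorphyDatum.gl n K hcpt).ofArch H₀ ψ ∈ V := by
    intro ψ hψ
    induction hψ using Submodule.span_induction with
    | mem x hx =>
      obtain ⟨p, hp, rfl⟩ := hx
      rw [← applyFree_ι_mul_of_isArchSmooth H₀ p (hsmooth φ₀ hφ₀W)]
      refine Submodule.subset_span ⟨_, ?_, rfl⟩
      unfold IsCentralWord
      rw [map_mul, freeToEnveloping_ι]
      exact Subalgebra.mul_mem _ (ι_mem_centerU_of_forall_lie_eq_zero hcent) hp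
    | zero => rw [lieDeriv_zero]; exact Submodule.zero_mem _
    | add x y hx hy hx' hy' =>
      rw [IsArchSmooth.lieDeriv_add _ H₀ (hVsmooth x hx) (hVsmooth y hy)]
      exact Submodule.add_mem _ hx' hy'
    | smul c x hx hx' =>
      rw [lieDeriv_smul]
      exact Submodule.smul_mem _ c hx'
  have hφ₀V : φ₀ ∈ V := by
    refine Submodule.subset_span ⟨1, ?_, (applyFree_one _ φ₀).symm⟩
    unfold IsCentralWord
    rw [map_one]
    exact Subalgebra.one_mem _
  -- an eigenvector of the Lie derivative along `1` on `V`
  let T : V →ₗ[ℂ] V :=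
    { toFun := fun v => ⟨lieDeriv (AutomorphyDatum.gl n K hcpt).ofArch H₀ v, hTV v v.2⟩
      map_add' := fun v w => Subtype.ext
        (IsArchSmooth.lieDeriv_add _ H₀ (hVsmooth _ v.2) (hVsmooth _ w.2))
      map_smul' := fun c v => Subtype.ext (by
        change lieDeriv _ H₀ (c • (v : (AdelicGroupData.gl n K).Adelic → ℂ)) =
          c • lieDeriv _ H₀ (v : (AdelicGroupData.gl n K).Adelic → ℂ)
        exact lieDeriv_smul H₀ c _) }
  haveI : Nontrivial V := ⟨⟨⟨φ₀, hφ₀V⟩, 0, fun h => hφ₀0 (congrArg Subtype.val h)⟩⟩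
  obtain ⟨μ, hμ⟩ := Module.End.exists_eigenvalue T
  obtain ⟨v, hv⟩ := hμ.exists_hasEigenvector
  have hψ₀ : lieDeriv (AutomorphyDatum.gl n K hcpt).ofArch H₀ (v : _ → ℂ) = μ • (v : _ → ℂ) :=
    congrArg Subtype.val (Module.End.mem_eigenspace_iff.1 hv.1)
  have hv0 : (v : (AdelicGroupData.gl n K).Adelic → ℂ) ≠ 0 := fun h => hv.2 (Subtype.ext h)
  refine ⟨μ, ?_⟩
  -- the eigenspace of `μ` in `W` is a non-zero stable subspace
  let E : Submodule ℂ ((AdelicGroupData.gl n K).Adelic → ℂ) :=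
    { carrier := {ψ | ψ ∈ π.W ∧ lieDeriv (AutomorphyDatum.gl n K hcpt).ofArch H₀ ψ = μ • ψ}
      zero_mem' := ⟨Submodule.zero_mem _, by rw [lieDeriv_zero, smul_zero]⟩
      add_mem' := fun {a b} ha hb => ⟨Submodule.add_mem _ ha.1 hb.1, by
        rw [IsArchSmooth.lieDeriv_add _ H₀ (hsmooth a ha.1) (hsmooth b hb.1), ha.2, hb.2, smul_add]⟩
      smul_mem' := fun c a ha => ⟨Submodule.smul_mem _ c ha.1, by
        rw [lieDeriv_smul, ha.2, smul_comm]⟩ }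
  have hEW : E ≤ π.W := fun ψ h => h.1
  have hcomm : ∀ (t : ℝ) (h : (AdelicGroupData.gl n K).Adelic),
      (h ∈ (AutomorphyDatum.gl n K hcpt).finiteAdelic ∨ ∃ k, h = (AutomorphyDatum.gl n K hcpt).ofK k) →
      (AutomorphyDatum.gl n K hcpt).ofArch ((AutomorphyDatum.gl n K hcpt).arch.expMem (t • H₀)) * h =
        h * (AutomorphyDatum.gl n K hcpt).ofArch ((AutomorphyDatum.gl n K hcpt).arch.expMem (t • H₀)) := by
    rintro t h (hh | ⟨k, rfl⟩)
    · exact (AutomorphyDatum.gl n K hcpt).commute_ofArch _ h hh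
    · rw [AutomorphyDatum.ofK_apply, ← map_mul, ← map_mul]
      congr 1
      exact Subtype.ext (expMem_smul_one_mul_comm t _)
  have hEst : IsStableSubmodule (AutomorphyDatum.gl n K hcpt) E :=
    { le_automorphicForms := hEW.trans π.stable.le_automorphicForms
      finite_stable := fun h hh ψ hψ => ⟨π.stable.finite_stable h hh hψ.1, by
        rw [lieDeriv_rightTranslation_of_forall_commute H₀ (fun t => hcomm t h (Or.inl hh)), hψ.2, map_smul]⟩
      k_stable := fun k ψ hψ => ⟨π.stable.k_stable k hψ.1, by
        rw [lieDeriv_rightTranslation_of_forall_commute H₀ (fun t => hcomm t _ (Or.inr ⟨k, rfl⟩)), hψ.2,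
          map_smul]⟩
      lie_stable := fun X ψ hψ => ⟨π.stable.lie_stable X ψ hψ.1, by
        rw [lieDeriv_comm_of_lie_eq_zero _ (hcent X) (hsmooth ψ hψ.1), hψ.2, lieDeriv_smul]⟩ }
  rcases π.irreducible E (by rw [hW']; exact bot_le) hEW hEst with h | h
  · exfalso
    have hvE : (v : (AdelicGroupData.gl n K).Adelic → ℂ) ∈ E := ⟨hVW v.2, hψ₀⟩
    rw [h, hW'] at hvE
    exact hv0 ((Submodule.mem_bot ℂ).1 hvE)
  · intro φ hφ
    rw [← h] at hφ
    exact hφ.2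

/-- **The split component acts by a quasi-character**: for an irreducible automorphic representation
`π = W / ⊥` of `GL_n(𝔸_K)` there is `μ ∈ ℂ` with `φ (a g) = a^μ φ (g)` for all `φ ∈ W`, `g`, and
`a ∈ A_G = ℝ_{>0}` (`posRealScalar`; `a = exp (log a · 1)` and `1` acts by `μ`, so
`t ↦ φ (g exp (t · 1))` solves `u' = μ u`). For cuspidal `π` this is the restriction to `A_G` of its
central character; `π ⊗ |det|^{-μ/(n[K:ℚ])}` is then trivial on `A_G` (Borel–Jacquet 1979, 5.7;
Arthur–Clozel 1989, Ch. 3, proof of Thm. 3.1: "We may assume `π, π'` unitary"). [cite: BorelJacquetCorvallis1979, 5.7] -/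
theorem AutomorphicRepData.exists_apply_posRealScalar_mul_eq_cpow
    (π : AutomorphicRepData (AutomorphyDatum.gl n K hcpt)) (hW' : π.W' = ⊥) :
    ∃ μ : ℂ, ∀ φ ∈ π.W, ∀ (t : ℝ≥0ˣ) (g : (AdelicGroupData.gl n K).Adelic),
      φ ((show (AdelicGroupData.gl n K).Adelic from posRealScalar n K t) * g) =
        (((t : ℝ≥0) : ℝ) : ℂ) ^ μ * φ g := by
  obtain ⟨μ, hμ⟩ := π.exists_lieDeriv_one_eq_smul hW'
  refine ⟨μ, fun φ hφ t g => ?_⟩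
  have ht : (0 : ℝ) < ((t : ℝ≥0) : ℝ) := NNReal.coe_pos.2 (pos_iff_ne_zero.2 t.ne_zero)
  have hcomm : (show (AdelicGroupData.gl n K).Adelic from posRealScalar n K t) * g =
      g * (show (AdelicGroupData.gl n K).Adelic from posRealScalar n K t) :=
    (Subgroup.mem_center_iff.1 (posRealScalar_mem_center n K t) g).symm
  rw [hcomm,
    posRealScalar_eq_ofArch_expMem (hcpt := hcpt) t,
    apply_mul_expMem_eq_exp_mul_of_lieDeriv_eq_smul _ (π.stable.isArchSmooth hφ) (hμ φ hφ) g]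
  congr 1
  rw [Complex.cpow_def_of_ne_zero (Complex.ofReal_ne_zero.2 ht.ne'), ← Complex.ofReal_log ht.le, mul_comm]

end Center

end Literature.NumberTheory.Automorphic
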